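import Summits.MatrixMultiplication.MatrixMultiplication.Theses.FarEdgeDescent
import Summits.MatrixMultiplication.MatrixMultiplication.Theses.SaturationLadder
import Literature.Computability.AlgebraicComplexity.RectangularExponentInformationBound
import HarnessLib

/-!
# Cross-route bridge `FarEdgeDescent → SaturationLadder`: the law `AnchoredLogConvexity` carries the
ladder's residuals `FiniteToSquare` (stmt-25912), `SquareFromTwo` (stmt-29475) and `TailDescentTwo` — and
already its restriction to the smallest window `(1, 3/2]` carries `SquareFromTwo` — all PROVED

Route `SaturationLadder` (lens 1) decides `ω = 2` through an onset ladder whose bottom rungs are bare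
IMPLICATIONS between necessary statements — `FiniteToSquare : (∃ k ≥ 2, e(k) = 0) → ω = 2` (aside 25912),
split as `TailDescentTwo ∧ SquareFromTwo` with `SquareFromTwo : ω(1,2,1) = 3 → ω = 2` its DECLARED RESIDUAL
(crux 29475) — for which the census records «no computable handle» (forest-check lever, 2026-08-30).
Route `FarEdgeDescent` (lens 2) types the generic side as a LAW about the true exponents,
`AnchoredLogConvexity : ∀ m > 1, e(m)² ≤ e(1)·e(2m−1)` (crux 28900, `e(x) := ω(1,x,1) − (x+1)`), which HAS a
numerical instrument (every published rectangular bound is a data point).  This file lands the edges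
between the two routes, by name:

* `finiteToSquare_of_anchoredLogConvexity`, `squareFromTwo_of_anchoredLogConvexity`,
  `tailDescentTwo_of_anchoredLogConvexity`: the law implies all three ladder pieces (through the route's
  deciding theorem `FarEdgeDescent.closes`);
* THE DIAL (special ↔ generic trade-off), hypothesis-explicit: the law restricted to a WINDOW `(1, M]`
  together with ONE saturated real shape `k₀ ∈ (1, 2M − 1]` already gives `ω = 2`
  (`mm_of_saturated_of_alcWindow`: halving orbit `k_n = 1 + (k₀−1)/2ⁿ` inside the window, closed at the
  square by MONOTONICITY `ω = ω(1,1,1) ≤ ω(1,k_n,1) = k_n + 1 → 2`); its `K = 2` member: the law on the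
  smallest window `(1, 3/2]` implies `SquareFromTwo` (`squareFromTwo_of_alcWindow`), and EXACTLY
  `ω = 2 ⟺ ω(1,2,1) = 3 ∧ (law on (1, 3/2])` (`mm_iff_twoSaturation_and_alcWindow`) — lens 1's OR-node
  `E₂` and lens 2's law meet at the cheapest possible place.

Written by the decomp-mm lens-2 planner seat (gen 8) from the kernel `HOME/decomp-mm-lens-2/FarEdgeDescent_v7.lean`
(§C «trade-off family», «cross-route certificate»); imports only BUILT modules (the two route files + Literature).
[cite: LottiRomani1983, §2 (p. 174)] [cite: HuangPan1998, §8]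
-/

set_option linter.dupNamespace false

noncomputable section

namespace Summit.MatrixMultiplication.MatrixMultiplication.Theorems.FarEdgeDescentLadderBridge

open Literature.Computability.AlgebraicComplexity
open Summit.MatrixMultiplication.MatrixMultiplication.Theses

/-! ## The law carries the ladder's residuals -/

/-- `AnchoredLogConvexity → FiniteToSquare` (SaturationLadder aside stmt-25912): the route's deciding
theorem read as an implication. -/
theorem finiteToSquare_of_anchoredLogConvexity (hA : FarEdgeDescent.AnchoredLogConvexity) :
    SaturationLadder.FiniteToSquare :=
  fun hF => FarEdgeDescent.closes hF hA

/-- `AnchoredLogConvexity → SquareFromTwo` (SaturationLadder crux stmt-29475, its declared residual):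
`ω(1,2,1) = 3` is `FiniteSaturation` with witness `k = 2`. -/
theorem squareFromTwo_of_anchoredLogConvexity (hA : FarEdgeDescent.AnchoredLogConvexity) :
    SaturationLadder.SquareFromTwo :=
  fun hE => FarEdgeDescent.closes ⟨2, le_rfl, by push_cast; rw [hE]; norm_num⟩ hA

/-- Under `ω = 2` (the summit) every shape `x ≥ 1` is saturated (Huang–Pan sandwich,
`omegaRect_eq_sub_min_of_omega_eq_two`). -/
theorem saturated_of_mm (h : _root_.MatrixMultiplication) {x : ℝ} (hx : 1 ≤ x) :
    omegaRect ℂ 1 x 1 = x + 1 := by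
  rw [_root_.MatrixMultiplication_iff] at h
  have h' := omegaRect_eq_sub_min_of_omega_eq_two ℂ h (r := 1) (s := x) (t := 1) zero_le_one
    (by linarith) zero_le_one
  rw [min_eq_right hx, min_self] at h'
  linarith

/-- `AnchoredLogConvexity → TailDescentTwo` (SaturationLadder crux: a saturated integer shape `k ≥ 3`
forces `ω(1,2,1) = 3`): via `ω = 2`. -/
theorem tailDescentTwo_of_anchoredLogConvexity (hA : FarEdgeDescent.AnchoredLogConvexity) :
    SaturationLadder.TailDescentTwo := by
  rintro ⟨k, hk, hs⟩
  have hS := FarEdgeDescent.closes ⟨k, by omega, hs⟩ hA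
  have h2 := saturated_of_mm hS (x := 2) (by norm_num)
  rw [h2]
  norm_num

/-! ## The dial: the law on a window `(1, M]` plus one saturated shape `k₀ ≤ 2M − 1` gives `ω = 2` -/

/-- **Halving step inside a window.**  If the law holds for `1 < m ≤ M` and the real shape `k > 1` with
`(k+1)/2 ≤ M` is saturated, then `(k+1)/2` is saturated: `e((k+1)/2)² ≤ e(1)·e(k) = 0`. -/
theorem halving_step_of_alcWindow {M : ℝ}
    (hA : ∀ m : ℝ, 1 < m → m ≤ M →
      (omegaRect ℂ 1 m 1 - (m + 1)) ^ 2 ≤ (omegaRect ℂ 1 1 1 - 2) * (omegaRect ℂ 1 (2 * m - 1) 1 - 2 * m))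
    {k : ℝ} (hk : 1 < k) (hkM : (k + 1) / 2 ≤ M) (hs : omegaRect ℂ 1 k 1 = k + 1) :
    omegaRect ℂ 1 ((k + 1) / 2) 1 = (k + 1) / 2 + 1 := by
  have h := hA ((k + 1) / 2) (by linarith) hkM
  have hz : omegaRect ℂ 1 (2 * ((k + 1) / 2) - 1) 1 - 2 * ((k + 1) / 2) = 0 := by
    rw [show 2 * ((k + 1) / 2) - 1 = k by ring, hs]; ring
  rw [hz, mul_zero] at h
  have hsq := le_antisymm h (sq_nonneg _)
  have hlin := (pow_eq_zero_iff two_ne_zero).1 hsq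
  linarith

/-- **The halving orbit stays in the window**: from a saturated `k₀ > 1` with `(k₀+1)/2 ≤ M`, every
`k_n = 1 + (k₀−1)/2ⁿ` is saturated. -/
theorem orbit_saturated_of_alcWindow {M : ℝ}
    (hA : ∀ m : ℝ, 1 < m → m ≤ M →
      (omegaRect ℂ 1 m 1 - (m + 1)) ^ 2 ≤ (omegaRect ℂ 1 1 1 - 2) * (omegaRect ℂ 1 (2 * m - 1) 1 - 2 * m))
    {k₀ : ℝ} (hk₀ : 1 < k₀) (hM : (k₀ + 1) / 2 ≤ M) (hs : omegaRect ℂ 1 k₀ 1 = k₀ + 1) (n : ℕ) :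
    omegaRect ℂ 1 (1 + (k₀ - 1) / 2 ^ n) 1 = (1 + (k₀ - 1) / 2 ^ n) + 1 := by
  induction n with
  | zero =>
    have e : 1 + (k₀ - 1) / 2 ^ 0 = k₀ := by rw [pow_zero, div_one]; ring
    rw [e]; exact hs
  | succ n ih =>
    have hpos : 0 < (k₀ - 1) / 2 ^ n := div_pos (by linarith) (pow_pos two_pos n)
    have hle : (k₀ - 1) / 2 ^ n ≤ k₀ - 1 :=
      div_le_self (by linarith) (one_le_pow₀ (by norm_num : (1 : ℝ) ≤ 2))
    have h := halving_step_of_alcWindow hA (k := 1 + (k₀ - 1) / 2 ^ n) (by linarith) (by linarith) ih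
    have e : (1 + (k₀ - 1) / 2 ^ n + 1) / 2 = 1 + (k₀ - 1) / 2 ^ (n + 1) := by
      rw [pow_succ]; field_simp; ring
    rw [e] at h
    exact h

/-- **The dial.**  The law on the window `(1, M]` and ONE saturated real shape `k₀ ∈ (1, 2M−1]` give
`ω = 2`: the orbit is saturated and `ω = ω(1,1,1) ≤ ω(1,k_n,1) = k_n + 1 = 2 + (k₀−1)/2ⁿ` for every `n`
(monotonicity of the profile, `omegaRect_one_mid_one_mono`) — no convexity needed at the square. -/
theorem mm_of_saturated_of_alcWindow {M : ℝ}
    (hA : ∀ m : ℝ, 1 < m → m ≤ M →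
      (omegaRect ℂ 1 m 1 - (m + 1)) ^ 2 ≤ (omegaRect ℂ 1 1 1 - 2) * (omegaRect ℂ 1 (2 * m - 1) 1 - 2 * m))
    {k₀ : ℝ} (hk₀ : 1 < k₀) (hM : (k₀ + 1) / 2 ≤ M) (hs : omegaRect ℂ 1 k₀ 1 = k₀ + 1) :
    _root_.MatrixMultiplication := by
  rw [_root_.MatrixMultiplication_iff]
  have hge : 2 ≤ omega ℂ := by
    have h := add_one_le_omegaRect_one_mid_one ℂ (1 : ℝ)
    rw [omegaRect_one_one_one] at h
    linarith
  refine le_antisymm ?_ hge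
  have hb : ∀ n : ℕ, omega ℂ ≤ 2 + (k₀ - 1) / 2 ^ n := by
    intro n
    have hnn : 0 ≤ (k₀ - 1) / 2 ^ n := div_nonneg (by linarith) (pow_pos two_pos n).le
    have hmono := omegaRect_one_mid_one_mono ℂ (p := 1) (q := 1 + (k₀ - 1) / 2 ^ n) (by linarith)
    rw [omegaRect_one_one_one, orbit_saturated_of_alcWindow hA hk₀ hM hs n] at hmono
    linarith
  by_contra hlt
  rw [not_le] at hlt
  have hk1 : 0 < k₀ - 1 := by linarith
  obtain ⟨n, hn⟩ := exists_pow_lt_of_lt_one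
    (div_pos (by linarith : 0 < omega ℂ - 2) hk1) (by norm_num : (1 / 2 : ℝ) < 1)
  have e : (k₀ - 1) / 2 ^ n = (1 / 2) ^ n * (k₀ - 1) := by
    rw [one_div_pow, mul_comm, ← div_eq_mul_one_div]
  rw [lt_div_iff₀ hk1] at hn
  have h := hb n
  rw [e] at h
  linarith

/-- The full law restricts to every window (for use with the dial). -/
theorem alcWindow_of_anchoredLogConvexity (hA : FarEdgeDescent.AnchoredLogConvexity) (M : ℝ) :
    ∀ m : ℝ, 1 < m → m ≤ M →
      (omegaRect ℂ 1 m 1 - (m + 1)) ^ 2 ≤ (omegaRect ℂ 1 1 1 - 2) * (omegaRect ℂ 1 (2 * m - 1) 1 - 2 * m) :=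
  fun m hm _ => hA m hm

/-! ## The `K = 2` member: the law on `(1, 3/2]` carries `SquareFromTwo`, and exactly so -/

/-- **The law on the smallest window `(1, 3/2]` implies `SquareFromTwo`** (stmt-29475): from `e(2) = 0`
the orbit `3/2, 5/4, 9/8, …` needs the law only at `m ≤ 3/2`. -/
theorem squareFromTwo_of_alcWindow
    (hA : ∀ m : ℝ, 1 < m → m ≤ 3 / 2 →
      (omegaRect ℂ 1 m 1 - (m + 1)) ^ 2 ≤ (omegaRect ℂ 1 1 1 - 2) * (omegaRect ℂ 1 (2 * m - 1) 1 - 2 * m)) :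
    SaturationLadder.SquareFromTwo :=
  fun hE => mm_of_saturated_of_alcWindow hA (k₀ := 2) (by norm_num) (by norm_num) (by rw [hE]; norm_num)

/-- **Exactness of the `K = 2` member of the dial**: `ω = 2 ⟺ ω(1,2,1) = 3 ∧ (law on (1, 3/2])` —
lens 1's special piece `E₂` and lens 2's law on the cheapest window are JOINTLY equivalent to the summit,
each being necessary. -/
theorem mm_iff_twoSaturation_and_alcWindow :
    _root_.MatrixMultiplication ↔
      omegaRect ℂ 1 2 1 = 3 ∧
      ∀ m : ℝ, 1 < m → m ≤ 3 / 2 →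
        (omegaRect ℂ 1 m 1 - (m + 1)) ^ 2 ≤ (omegaRect ℂ 1 1 1 - 2) * (omegaRect ℂ 1 (2 * m - 1) 1 - 2 * m) := by
  constructor
  · intro h
    refine ⟨by rw [saturated_of_mm h (x := 2) (by norm_num)]; norm_num, fun m hm _ => ?_⟩
    have hω : omega ℂ = 2 := _root_.MatrixMultiplication_iff.1 h
    rw [saturated_of_mm h hm.le, saturated_of_mm h (x := 2 * m - 1) (by linarith), omegaRect_one_one_one, hω]
    nlinarith
  · rintro ⟨hE, hA⟩
    exact squareFromTwo_of_alcWindow hA hE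

/-- The general member, integer form: the law on `(1, (K+1)/2]` and `FiniteSaturation` with a witness
`k ≤ K` give `ω = 2` — the larger the saturated shape one is willing to produce, the larger the window on
which the law must be established, and conversely. -/
theorem mm_of_finiteSaturation_le_of_alcWindow {K : ℝ}
    (hA : ∀ m : ℝ, 1 < m → m ≤ (K + 1) / 2 →
      (omegaRect ℂ 1 m 1 - (m + 1)) ^ 2 ≤ (omegaRect ℂ 1 1 1 - 2) * (omegaRect ℂ 1 (2 * m - 1) 1 - 2 * m))
    {k : ℕ} (hk : 2 ≤ k) (hkK : (k : ℝ) ≤ K) (hs : omegaRect ℂ 1 k 1 = k + 1) :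
    _root_.MatrixMultiplication :=
  mm_of_saturated_of_alcWindow hA (k₀ := (k : ℝ)) (by exact_mod_cast (by omega : 1 < k)) (by linarith) hs

end Summit.MatrixMultiplication.MatrixMultiplication.Theorems.FarEdgeDescentLadderBridge

end
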